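import Summits.QuantumFields.YangMills.Theorems.ConvexGribovBodyNonSimplyConnectedLatticeGapWeakMixingFunnel
import Literature.MathematicalPhysics.QuantumFieldTheory.Sweep1ShenZhuZhuProofs
import HarnessLib

/-!
# DLR uniqueness implies the unique thermodynamic limit of the torus Wilson states
# (stub `stub_uniqueInfiniteVolumeLimit_of_dlrUnique` (HL) of crux stmt-QuantumFields-16405,
# route `ConvexGribovBody`, line `Sketch` v7)

For the lattice Yang–Mills specification `γ = ymSpecification ρ β` on `ℤ⁴` (compact metrisable gauge group `G`,
continuous representation `ρ`): if `𝒢(γ)` has at most one element, then the full sequence of torus Wilson states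
`μ_{Λ_{L+1}, β}` converges on bounded continuous cylinder observables to a probability measure `μ`, and `μ` is the
only subsequential limit point, i.e. the body of the tree notion `HasUniqueInfiniteVolumeLimit (d := 4) ρ β`.
Proof (Friedli–Velenik 2017, Lemma 6.30 with Thm. 6.26; Georgii 2011, Thm. 4.17): limit points exist
(`infiniteVolumeLimitPoints_nonempty_holds`, compactness of the space of probability measures on `G^{edges(ℤ⁴)}`);
every limit point is a DLR state (`mem_ymGibbsMeasures_of_mem_infiniteVolumeLimitPoints_holds`); so all limit points
coincide with the chosen one, `μ`, and the full sequence of torus states converges to `μ`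
(`tendsto_integral_torusState_of_subsingleton`, after `⟨F ∘ torusLift⟩_{L+1} = ∫ F d(torusState ρ β (L+1))`,
`wilsonExpectation_toTorusObservable`).
-/

set_option autoImplicit false

noncomputable section

open MeasureTheory Filter Topology
open Literature.MathematicalPhysics.QuantumLattice
open Literature.MathematicalPhysics.QuantumFieldTheory (torusState wilsonExpectation_toTorusObservable
  tendsto_integral_torusState_of_subsingleton)

namespace Summit.QuantumFields.YangMills.Theorems.NonSimplyConnectedLatticeGap

section Helpers

variable {G : Type} [Group G] [TopologicalSpace G] [IsTopologicalGroup G] [CompactSpace G]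
  [MeasurableSpace G] [BorelSpace G] [SecondCountableTopology G] [T2Space G]
  {N : ℕ} (ρ : G →* Matrix (Fin N) (Fin N) ℂ)

/-- **DLR uniqueness ⇒ every DLR state is the infinite-volume limit of the full sequence of torus states.** If
`𝒢(ymSpecification ρ β)` is a subsingleton and `μ ∈ 𝒢(ymSpecification ρ β)`, then `μ` is a probability measure and
`⟨F ∘ torusLift (L+1)⟩_{Λ_{L+1}, β} → ∫ F dμ` for every bounded continuous (cylinder) observable `F`: the Wilson
expectation of the torus restriction is the `torusState` integral (`wilsonExpectation_toTorusObservable`), and the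
torus states converge to the unique DLR state (`tendsto_integral_torusState_of_subsingleton`). -/
theorem isInfiniteVolumeLimit_of_subsingleton (hρ : Continuous ρ) (β : ℝ)
    (hsub : (ymGibbsMeasures (d := 4) ρ β).Subsingleton) {μ : Measure (LGConfig 4 G)}
    (hμ : μ ∈ ymGibbsMeasures ρ β) : IsInfiniteVolumeLimit ρ β μ := by
  refine ⟨hμ.1, fun F S _ hFc hFb => ?_⟩
  obtain ⟨C, hC⟩ := hFb
  have hE : (fun k : ℕ => Literature.MathematicalPhysics.QuantumFieldTheory.wilsonExpectation (L := id k + 1) ρ β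
      (toTorusObservable (id k + 1) F)) = fun k => ∫ U, F U ∂(torusState ρ β (k + 1)) :=
    funext fun k => wilsonExpectation_toTorusObservable ρ β (k + 1) hFc.measurable
  rw [hE]
  exact tendsto_integral_torusState_of_subsingleton ρ hρ hsub hμ hFc hC

/-- **DLR uniqueness ⇒ the set of infinite-volume limit points is the singleton of any DLR state.** Limit points
exist (`infiniteVolumeLimitPoints_nonempty_holds`) and are DLR states
(`mem_ymGibbsMeasures_of_mem_infiniteVolumeLimitPoints_holds`), hence all equal to `μ` when `𝒢` is a subsingleton;
and `μ` itself is a limit point (it is the limit of the full sequence, `isInfiniteVolumeLimit_of_subsingleton`). -/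
theorem infiniteVolumeLimitPoints_eq_singleton_of_subsingleton (hρ : Continuous ρ) (β : ℝ)
    (hsub : (ymGibbsMeasures (d := 4) ρ β).Subsingleton) {μ : Measure (LGConfig 4 G)}
    (hμ : μ ∈ ymGibbsMeasures ρ β) : infiniteVolumeLimitPoints ρ β = {μ} :=
  Set.eq_singleton_iff_unique_mem.2
    ⟨(isInfiniteVolumeLimit_of_subsingleton ρ hρ β hsub hμ).mem_infiniteVolumeLimitPoints,
      fun _ hν => hsub (mem_ymGibbsMeasures_of_mem_infiniteVolumeLimitPoints_holds ρ hρ hν) hμ⟩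

end Helpers

/-- **DLR uniqueness ⇒ the unique thermodynamic limit of the torus states** (registered stub
`stub_uniqueInfiniteVolumeLimit_of_dlrUnique` (HL) of the skeleton `Cruxes/NonSimplyConnectedLatticeGap/Lines/Sketch.lean`
v7 of item stmt-QuantumFields-16405; conclusion = body of the tree notion `HasUniqueInfiniteVolumeLimit (d := 4) ρ β`):
if `𝒢(ymSpecification ρ β)` has at most one element then the full sequence of torus Wilson states converges and has
exactly one limit point. Pick a limit point `μ` (`infiniteVolumeLimitPoints_nonempty_holds`); it is a DLR state
(`mem_ymGibbsMeasures_of_mem_infiniteVolumeLimitPoints_holds`); conclude by `isInfiniteVolumeLimit_of_subsingleton`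
and `infiniteVolumeLimitPoints_eq_singleton_of_subsingleton`. -/
theorem stub_uniqueInfiniteVolumeLimit_of_dlrUnique : ∀ (G : Type) [Group G] [TopologicalSpace G] [IsTopologicalGroup G] [CompactSpace G] [MeasurableSpace G] [BorelSpace G] [SecondCountableTopology G] [T2Space G] (N : ℕ) (ρ : G →* Matrix (Fin N) (Fin N) ℂ), Continuous ρ → ∀ (β : ℝ), (∀ μ ν : MeasureTheory.Measure (Literature.MathematicalPhysics.QuantumLattice.LGConfig 4 G), μ ∈ Literature.MathematicalPhysics.QuantumLattice.ymGibbsMeasures ρ β → ν ∈ Literature.MathematicalPhysics.QuantumLattice.ymGibbsMeasures ρ β → μ = ν) → ∃ μ : MeasureTheory.Measure (Literature.MathematicalPhysics.QuantumLattice.LGConfig 4 G), Literature.MathematicalPhysics.QuantumLattice.IsInfiniteVolumeLimit ρ β μ ∧ Literature.MathematicalPhysics.QuantumLattice.infiniteVolumeLimitPoints ρ β = {μ} := by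
  intro G _ _ _ _ _ _ _ _ N ρ hρ β h
  have hsub : (ymGibbsMeasures (d := 4) ρ β).Subsingleton := fun μ hμ ν hν => h μ ν hμ hν
  obtain ⟨μ, hμlim⟩ := infiniteVolumeLimitPoints_nonempty_holds (d := 4) ρ hρ β
  have hμG : μ ∈ ymGibbsMeasures ρ β := mem_ymGibbsMeasures_of_mem_infiniteVolumeLimitPoints_holds ρ hρ hμlim
  exact ⟨μ, isInfiniteVolumeLimit_of_subsingleton ρ hρ β hsub hμG,
    infiniteVolumeLimitPoints_eq_singleton_of_subsingleton ρ hρ β hsub hμG⟩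

end Summit.QuantumFields.YangMills.Theorems.NonSimplyConnectedLatticeGap

end
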